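import Literature.NumberTheory.Transcendental.AnalytificationSeparatedProofs
import HarnessLib

/-!
# Stationarity of «same image» relations on complex points ([Deligne 1971] proof of Prop. 1.15)

Topic `AlgebraicGeometry/Motives`; namespace `Literature.AlgebraicGeometry.Motives`.  Theorems only (no definition,
no named fact, no `sorry`).

Let `X` be a `ℂ`-scheme of finite type and `f_m : X ⟶ W_m` (`m ∈ ℕ`) a sequence of `ℂ`-morphisms to separated
`ℂ`-schemes.  On complex points consider the relations
`R_m := {(P, Q) ∈ X(ℂ)² | f_m(P) = f_m(Q)}` — here read on the complex points `R` of `X ×_ℂ X` as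
`f_m(pr₁ R) = f_m(pr₂ R)`.  Each `R_m` is the trace on `(X ×_ℂ X)(ℂ)` of the CLOSED subset
`(f_m × f_m)⁻¹(Δ_{W_m}) ⊆ X ×_ℂ X` (`W_m` separated; `AlgPoints.setOf_pt_mem_range_diagonal`), and `X ×_ℂ X` is a
Noetherian topological space, so:

* `exists_forall_le_setOf_map_eq_eq` — if `m ↦ R_m` is ANTITONE then it is EVENTUALLY CONSTANT;
* `exists_setOf_map_eq_eq_iInter` — hence some `R_{m₀}` equals `⋂_m R_m`;
* `exists_setOf_map_eq_eq_of_iInter_eq` — in particular if `⋂_m R_m` is the diagonal (the `f_m` JOINTLY separate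
  points) then a SINGLE `f_{m₀}` already separates points: `R_{m₀} = {pr₁ R = pr₂ R}`;
* `exists_injective_map_of_iInter_eq_diagonal`, `exists_forall_le_map_eq_iff` — pair forms on `X(ℂ) × X(ℂ)` through
  `AlgPoints.prodEquiv` (the second in the successive-step / `eqLocus` phrasing of B-p05's parallel draft).

This is the Noetherian-stationarity step «la suite décroissante des `_{K(N)}R` est stationnaire» in the proof of
[Deligne1971TravauxShimura] Prop. 1.15 (p. 132): injectivity at infinite level + stationarity ⇒ injectivity at a finite
level.  Cell hodgecm-mathlib, row I-1′ (`F1ExtHodgeType` v4, `stub_S2inj` Step B2, leaf Q2 of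
`B-plan/I1prime-RECEPTACLE-PLAN.md` §7.4).  HC_CM is proved only modulo the 7 printed citations until rung 0 closes; this
file proves no cell binder (banked generic leaf, no floor change).

## References
* [Deligne1971TravauxShimura] P. Deligne, *Travaux de Shimura*, Sém. Bourbaki 389 (1971), Prop. 1.15 and Lemme 1.15.3,
  p. 132.
* [GortzWedhorn2020] U. Görtz, T. Wedhorn, *Algebraic Geometry I* (2nd ed. 2020), §(1.9)–(1.10) (Noetherian
  topological spaces: descending chains of closed subsets are stationary), Def. 9.7 / Prop. 9.8 (separated: diagonal
  closed).
-/

noncomputable section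

open CategoryTheory CategoryTheory.Limits AlgebraicGeometry MonoidalCategory Topology TopologicalSpace

namespace Literature.AlgebraicGeometry.Motives

variable {X : SchemeOver ℂ}

/-! ### `X ×_ℂ X` is a Noetherian topological space for `X` of finite type -/

/-- For `X` of finite type over `ℂ` (locally of finite type and quasi-compact), the underlying space of `X ×_ℂ X`
is Noetherian. [cite: GortzWedhorn2020, §(1.9)–(1.10) and Prop. 3.21] -/
theorem noetherianSpace_tensor_left [LocallyOfFiniteType X.hom] [QuasiCompact X.hom] :
    NoetherianSpace ↥(X ⊗ X).left := by
  haveI : IsLocallyNoetherian X.left := LocallyOfFiniteType.isLocallyNoetherian X.hom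
  haveI : IsLocallyNoetherian (pullback X.hom X.hom) := inferInstance
  haveI : CompactSpace ↥(Spec (CommRingCat.of ℂ)) := inferInstance
  haveI : CompactSpace ↥(pullback X.hom X.hom) :=
    QuasiCompact.compactSpace_of_compactSpace (pullback.fst X.hom X.hom ≫ X.hom)
  haveI : IsNoetherian (pullback X.hom X.hom) := {}
  exact inferInstanceAs (NoetherianSpace ↥(pullback X.hom X.hom))

/-! ### The relation `f(pr₁ R) = f(pr₂ R)` is the trace of a closed subset of `X ×_ℂ X` -/

/-- **`{R ∈ (X ×_ℂ X)(ℂ) | f(pr₁ R) = f(pr₂ R)}` is the trace of the closed set `(f × f)⁻¹(Δ_W)`** for `f : X ⟶ W`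
with `W` separated over `ℂ`. [cite: GortzWedhorn2020, Def. 9.7 and Prop. 9.8] -/
theorem setOf_map_fst_eq_map_snd_eq_preimage {W : SchemeOver ℂ} (f : X ⟶ W) :
    {R : ComplexPoints (X ⊗ X) | AlgPoints.map f (AlgPoints.map (CartesianMonoidalCategory.fst X X) R) =
        AlgPoints.map f (AlgPoints.map (CartesianMonoidalCategory.snd X X) R)} =
      {R | R.pt ∈ ((f ⊗ₘ f).left : (X ⊗ X).left → (W ⊗ W).left) ⁻¹' Set.range (pullback.diagonal W.hom)} := by
  ext R
  have key := congrArg (fun S : Set (ComplexPoints (W ⊗ W)) => AlgPoints.map (f ⊗ₘ f) R ∈ S)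
    (AlgPoints.setOf_pt_mem_range_diagonal (X := W) (L := ℂ))
  simp only [Set.mem_setOf_eq, eq_iff_iff] at key
  rw [Set.mem_setOf_eq, Set.mem_setOf_eq, Set.mem_preimage, ← AlgPoints.pt_map]
  refine Iff.trans ?_ key.symm
  rw [← AlgPoints.map_comp_apply, ← AlgPoints.map_comp_apply, ← AlgPoints.map_comp_apply,
    ← AlgPoints.map_comp_apply, CartesianMonoidalCategory.tensorHom_fst, CartesianMonoidalCategory.tensorHom_snd]

/-- … in particular it is the trace of a CLOSED subset of `X ×_ℂ X`. [cite: GortzWedhorn2020, Def. 9.7 and Prop. 9.8] -/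
theorem isClosed_preimage_range_diagonal {W : SchemeOver ℂ} [IsSeparated W.hom] (f : X ⟶ W) :
    IsClosed (((f ⊗ₘ f).left : (X ⊗ X).left → (W ⊗ W).left) ⁻¹' Set.range (pullback.diagonal W.hom)) :=
  (pullback.diagonal W.hom).isClosedEmbedding.isClosed_range.preimage (f ⊗ₘ f).left.continuous

/-! ### Stationarity -/

/-- **An antitone sequence of «same image under `f_m`» relations on `(X ×_ℂ X)(ℂ)` is eventually constant** (`X` of
finite type over `ℂ`, `W_m` separated): the relations are traces of the closed sets `⋂_{k ≤ m} (f_k × f_k)⁻¹(Δ)`, a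
descending chain in the Noetherian space `X ×_ℂ X`. [cite: Deligne1971TravauxShimura, proof of Prop. 1.15 p. 132]
[cite: GortzWedhorn2020, §(1.9)–(1.10)] -/
theorem exists_forall_le_setOf_map_eq_eq [NoetherianSpace ↥(X ⊗ X).left] {W : ℕ → SchemeOver ℂ}
    [∀ m, IsSeparated (W m).hom] (f : ∀ m, X ⟶ W m)
    (hanti : Antitone fun m => {R : ComplexPoints (X ⊗ X) |
      AlgPoints.map (f m) (AlgPoints.map (CartesianMonoidalCategory.fst X X) R) =
        AlgPoints.map (f m) (AlgPoints.map (CartesianMonoidalCategory.snd X X) R)}) :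
    ∃ m₀, ∀ m, m₀ ≤ m →
      {R : ComplexPoints (X ⊗ X) |
        AlgPoints.map (f m) (AlgPoints.map (CartesianMonoidalCategory.fst X X) R) =
          AlgPoints.map (f m) (AlgPoints.map (CartesianMonoidalCategory.snd X X) R)} =
      {R : ComplexPoints (X ⊗ X) |
        AlgPoints.map (f m₀) (AlgPoints.map (CartesianMonoidalCategory.fst X X) R) =
          AlgPoints.map (f m₀) (AlgPoints.map (CartesianMonoidalCategory.snd X X) R)} := by
  -- the closed sets and their descending partial intersections
  let Z : ℕ → Closeds ↥(X ⊗ X).left := fun m => ⟨_, isClosed_preimage_range_diagonal (f m)⟩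
  let Z' : ℕ → Closeds ↥(X ⊗ X).left := fun m =>
    ⟨⋂ k, ⋂ (_ : k ≤ m), (Z k : Set ↥(X ⊗ X).left),
      isClosed_iInter fun k => isClosed_iInter fun _ => (Z k).isClosed⟩
  have hmemZ' : ∀ m (x : ↥(X ⊗ X).left), x ∈ (Z' m : Set ↥(X ⊗ X).left) ↔ ∀ k, k ≤ m → x ∈ (Z k : Set ↥(X ⊗ X).left) := by
    intro m x
    change x ∈ (⋂ k, ⋂ (_ : k ≤ m), (Z k : Set ↥(X ⊗ X).left)) ↔ _
    simp only [Set.mem_iInter]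
  have hZ'anti : Antitone Z' := by
    intro m n hmn x hx
    exact (hmemZ' m x).2 fun k hk => (hmemZ' n x).1 hx k (hk.trans hmn)
  -- traces: `R_m = {R | R.pt ∈ Z' m}` (antitone `R`)
  have htrace : ∀ m, {R : ComplexPoints (X ⊗ X) |
      AlgPoints.map (f m) (AlgPoints.map (CartesianMonoidalCategory.fst X X) R) =
        AlgPoints.map (f m) (AlgPoints.map (CartesianMonoidalCategory.snd X X) R)} =
      {R | R.pt ∈ (Z' m : Set ↥(X ⊗ X).left)} := by
    intro m
    ext R
    rw [Set.mem_setOf_eq, Set.mem_setOf_eq, hmemZ']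
    constructor
    · intro hR k hk
      have hk' : R ∈ {R : ComplexPoints (X ⊗ X) |
          AlgPoints.map (f k) (AlgPoints.map (CartesianMonoidalCategory.fst X X) R) =
            AlgPoints.map (f k) (AlgPoints.map (CartesianMonoidalCategory.snd X X) R)} :=
        hanti hk hR
      rw [setOf_map_fst_eq_map_snd_eq_preimage (f k)] at hk'
      exact hk'
    · intro hR
      have hm : R ∈ {R : ComplexPoints (X ⊗ X) | R.pt ∈ ((f m ⊗ₘ f m).left : (X ⊗ X).left → (W m ⊗ W m).left) ⁻¹'
          Set.range (pullback.diagonal (W m).hom)} := hR m le_rfl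
      rw [← setOf_map_fst_eq_map_snd_eq_preimage (f m)] at hm
      exact hm
  -- Noetherian stationarity of the closed chain
  obtain ⟨m₀, hm₀⟩ := WellFoundedLT.antitone_chain_condition hZ'anti
  refine ⟨m₀, fun m hm => ?_⟩
  rw [htrace m, htrace m₀, ← hm₀ m hm]

/-- **Some `R_{m₀}` equals `⋂_m R_m`** (antitone case). [cite: Deligne1971TravauxShimura, proof of Prop. 1.15 p. 132] -/
theorem exists_setOf_map_eq_eq_iInter [NoetherianSpace ↥(X ⊗ X).left] {W : ℕ → SchemeOver ℂ}
    [∀ m, IsSeparated (W m).hom] (f : ∀ m, X ⟶ W m)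
    (hanti : Antitone fun m => {R : ComplexPoints (X ⊗ X) |
      AlgPoints.map (f m) (AlgPoints.map (CartesianMonoidalCategory.fst X X) R) =
        AlgPoints.map (f m) (AlgPoints.map (CartesianMonoidalCategory.snd X X) R)}) :
    ∃ m₀, {R : ComplexPoints (X ⊗ X) |
        AlgPoints.map (f m₀) (AlgPoints.map (CartesianMonoidalCategory.fst X X) R) =
          AlgPoints.map (f m₀) (AlgPoints.map (CartesianMonoidalCategory.snd X X) R)} =
      ⋂ m, {R : ComplexPoints (X ⊗ X) |
        AlgPoints.map (f m) (AlgPoints.map (CartesianMonoidalCategory.fst X X) R) =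
          AlgPoints.map (f m) (AlgPoints.map (CartesianMonoidalCategory.snd X X) R)} := by
  obtain ⟨m₀, hm₀⟩ := exists_forall_le_setOf_map_eq_eq f hanti
  refine ⟨m₀, Set.Subset.antisymm ?_ (Set.iInter_subset _ m₀)⟩
  intro R hR
  simp only [Set.mem_iInter]
  intro m
  by_cases hm : m₀ ≤ m
  · rw [hm₀ m hm]; exact hR
  · exact hanti (le_of_not_ge hm) hR

/-- **Joint separation of points by the `f_m` is achieved at ONE level**: if the antitone relations `R_m` intersect
to the diagonal `{pr₁ R = pr₂ R}`, then `R_{m₀}` IS the diagonal for some `m₀` — i.e. `f_{m₀}(P) = f_{m₀}(Q) → P = Q`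
on complex points ([Deligne 1971] 1.15: injective at infinite level ⇒ injective at a finite level).
[cite: Deligne1971TravauxShimura, proof of Prop. 1.15 and Lemme 1.15.3, p. 132] -/
theorem exists_setOf_map_eq_eq_of_iInter_eq [NoetherianSpace ↥(X ⊗ X).left] {W : ℕ → SchemeOver ℂ}
    [∀ m, IsSeparated (W m).hom] (f : ∀ m, X ⟶ W m)
    (hanti : Antitone fun m => {R : ComplexPoints (X ⊗ X) |
      AlgPoints.map (f m) (AlgPoints.map (CartesianMonoidalCategory.fst X X) R) =
        AlgPoints.map (f m) (AlgPoints.map (CartesianMonoidalCategory.snd X X) R)})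
    (hinter : (⋂ m, {R : ComplexPoints (X ⊗ X) |
        AlgPoints.map (f m) (AlgPoints.map (CartesianMonoidalCategory.fst X X) R) =
          AlgPoints.map (f m) (AlgPoints.map (CartesianMonoidalCategory.snd X X) R)}) =
      {R | AlgPoints.map (CartesianMonoidalCategory.fst X X) R = AlgPoints.map (CartesianMonoidalCategory.snd X X) R}) :
    ∃ m₀, ∀ R : ComplexPoints (X ⊗ X),
      AlgPoints.map (f m₀) (AlgPoints.map (CartesianMonoidalCategory.fst X X) R) =
          AlgPoints.map (f m₀) (AlgPoints.map (CartesianMonoidalCategory.snd X X) R) →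
        AlgPoints.map (CartesianMonoidalCategory.fst X X) R = AlgPoints.map (CartesianMonoidalCategory.snd X X) R := by
  obtain ⟨m₀, hm₀⟩ := exists_setOf_map_eq_eq_iInter f hanti
  refine ⟨m₀, fun R hR => ?_⟩
  have : R ∈ (⋂ m, {R : ComplexPoints (X ⊗ X) |
        AlgPoints.map (f m) (AlgPoints.map (CartesianMonoidalCategory.fst X X) R) =
          AlgPoints.map (f m) (AlgPoints.map (CartesianMonoidalCategory.snd X X) R)}) := by
    rw [← hm₀]; exact hR
  rw [hinter] at this
  exact this

/-! ### On pairs of complex points `X(ℂ) × X(ℂ)` -/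

/-- **Pair form**: for `X` of finite type over `ℂ` (locally of finite type and quasi-compact), `W_m` separated and `f_m : X ⟶ W_m`: if the relations
`R_m = {(P,Q) | f_m P = f_m Q}` on `X(ℂ) × X(ℂ)` are antitone in `m` and `⋂_m R_m` is the diagonal, then some single
`f_{m₀}` is injective on complex points. [cite: Deligne1971TravauxShimura, proof of Prop. 1.15 and Lemme 1.15.3, p. 132] -/
theorem exists_injective_map_of_iInter_eq_diagonal [LocallyOfFiniteType X.hom] [QuasiCompact X.hom]
    {W : ℕ → SchemeOver ℂ} [∀ m, IsSeparated (W m).hom] (f : ∀ m, X ⟶ W m)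
    (hanti : Antitone fun m => {PQ : ComplexPoints X × ComplexPoints X |
      AlgPoints.map (f m) PQ.1 = AlgPoints.map (f m) PQ.2})
    (hinter : (⋂ m, {PQ : ComplexPoints X × ComplexPoints X | AlgPoints.map (f m) PQ.1 = AlgPoints.map (f m) PQ.2}) =
      {PQ | PQ.1 = PQ.2}) :
    ∃ m₀, Function.Injective (AlgPoints.map (L := ℂ) (f m₀)) := by
  haveI : NoetherianSpace ↥(X ⊗ X).left := noetherianSpace_tensor_left
  -- transport along `prodEquiv : (X ⊗ X)(ℂ) ≃ X(ℂ) × X(ℂ)`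
  have hfst : ∀ R : ComplexPoints (X ⊗ X), AlgPoints.map (CartesianMonoidalCategory.fst X X) R = (AlgPoints.prodEquiv R).1 :=
    fun R => (AlgPoints.prodEquiv_apply_fst R).symm
  have hsnd : ∀ R : ComplexPoints (X ⊗ X), AlgPoints.map (CartesianMonoidalCategory.snd X X) R = (AlgPoints.prodEquiv R).2 :=
    fun R => (AlgPoints.prodEquiv_apply_snd R).symm
  have hset : ∀ m, {R : ComplexPoints (X ⊗ X) |
      AlgPoints.map (f m) (AlgPoints.map (CartesianMonoidalCategory.fst X X) R) =
        AlgPoints.map (f m) (AlgPoints.map (CartesianMonoidalCategory.snd X X) R)} =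
      AlgPoints.prodEquiv ⁻¹' {PQ : ComplexPoints X × ComplexPoints X | AlgPoints.map (f m) PQ.1 = AlgPoints.map (f m) PQ.2} := by
    intro m; ext R; simp only [Set.mem_setOf_eq, Set.mem_preimage, hfst, hsnd]
  have hanti' : Antitone fun m => {R : ComplexPoints (X ⊗ X) |
      AlgPoints.map (f m) (AlgPoints.map (CartesianMonoidalCategory.fst X X) R) =
        AlgPoints.map (f m) (AlgPoints.map (CartesianMonoidalCategory.snd X X) R)} := by
    intro m n hmn R hR
    have hR' : R ∈ AlgPoints.prodEquiv ⁻¹'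
        {PQ : ComplexPoints X × ComplexPoints X | AlgPoints.map (f n) PQ.1 = AlgPoints.map (f n) PQ.2} := by
      rw [← hset n]; exact hR
    show R ∈ {R : ComplexPoints (X ⊗ X) |
      AlgPoints.map (f m) (AlgPoints.map (CartesianMonoidalCategory.fst X X) R) =
        AlgPoints.map (f m) (AlgPoints.map (CartesianMonoidalCategory.snd X X) R)}
    rw [hset m]
    exact Set.preimage_mono (hanti hmn) hR'
  have hinter' : (⋂ m, {R : ComplexPoints (X ⊗ X) |
        AlgPoints.map (f m) (AlgPoints.map (CartesianMonoidalCategory.fst X X) R) =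
          AlgPoints.map (f m) (AlgPoints.map (CartesianMonoidalCategory.snd X X) R)}) =
      {R | AlgPoints.map (CartesianMonoidalCategory.fst X X) R = AlgPoints.map (CartesianMonoidalCategory.snd X X) R} := by
    simp_rw [hset]
    rw [← Set.preimage_iInter, hinter]
    ext R; simp only [Set.mem_preimage, Set.mem_setOf_eq, hfst, hsnd]
  obtain ⟨m₀, hm₀⟩ := exists_setOf_map_eq_eq_of_iInter_eq f hanti' hinter'
  refine ⟨m₀, fun P Q hPQ => ?_⟩
  have h := hm₀ (AlgPoints.prodEquiv.symm (P, Q))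
  rw [hfst, hsnd, Equiv.apply_symm_apply] at h
  exact h hPQ

/-- **Pair form, eventual constancy**: for `X` of finite type over `ℂ`, `W_m` separated, `f_m : X ⟶ W_m` with
`f_{m+1} P = f_{m+1} Q → f_m P = f_m Q`: there is `m₀` with `f_m P = f_m Q ↔ f_{m₀} P = f_{m₀} Q` for all `m ≥ m₀`
and all complex points `P Q` (the shape `stub_S2inj` consumes; B-p05's `eqLocus` phrasing).
[cite: Deligne1971TravauxShimura, proof of Prop. 1.15 p. 132] -/
theorem exists_forall_le_map_eq_iff [LocallyOfFiniteType X.hom] [QuasiCompact X.hom]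
    {W : ℕ → SchemeOver ℂ} [∀ m, IsSeparated (W m).hom] (f : ∀ m, X ⟶ W m)
    (hstep : ∀ m (P Q : ComplexPoints X),
      AlgPoints.map (f (m + 1)) P = AlgPoints.map (f (m + 1)) Q → AlgPoints.map (f m) P = AlgPoints.map (f m) Q) :
    ∃ m₀, ∀ m, m₀ ≤ m → ∀ P Q : ComplexPoints X,
      AlgPoints.map (f m) P = AlgPoints.map (f m) Q ↔ AlgPoints.map (f m₀) P = AlgPoints.map (f m₀) Q := by
  haveI : NoetherianSpace ↥(X ⊗ X).left := noetherianSpace_tensor_left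
  have hfst : ∀ R : ComplexPoints (X ⊗ X), AlgPoints.map (CartesianMonoidalCategory.fst X X) R = (AlgPoints.prodEquiv R).1 :=
    fun R => (AlgPoints.prodEquiv_apply_fst R).symm
  have hsnd : ∀ R : ComplexPoints (X ⊗ X), AlgPoints.map (CartesianMonoidalCategory.snd X X) R = (AlgPoints.prodEquiv R).2 :=
    fun R => (AlgPoints.prodEquiv_apply_snd R).symm
  -- the relations on `(X ⊗ X)(ℂ)` are antitone (successive steps)
  have hanti : Antitone fun m => {R : ComplexPoints (X ⊗ X) |
      AlgPoints.map (f m) (AlgPoints.map (CartesianMonoidalCategory.fst X X) R) =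
        AlgPoints.map (f m) (AlgPoints.map (CartesianMonoidalCategory.snd X X) R)} := by
    refine antitone_nat_of_succ_le fun m R hR => ?_
    exact hstep m _ _ hR
  obtain ⟨m₀, hm₀⟩ := exists_forall_le_setOf_map_eq_eq f hanti
  refine ⟨m₀, fun m hm P Q => ?_⟩
  have h := congrArg (fun S : Set (ComplexPoints (X ⊗ X)) => AlgPoints.prodEquiv.symm (P, Q) ∈ S) (hm₀ m hm)
  simp only [Set.mem_setOf_eq, hfst, hsnd, Equiv.apply_symm_apply, eq_iff_iff] at h
  exact h

end Literature.AlgebraicGeometry.Motives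

end
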